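import Mathlib
import Literature.Analysis.UnboundedOperators.HeatKernel
import Literature.MathematicalPhysics.QuantumFieldTheory.Balaban1983to89.B1

/-!
# `Balaban1983to89.B1RT` — B1 §2, pp. 608–609: the renormalization transformations `T_{a,L,A}` for scalar
fields, their Gaussian kernels (2.4)–(2.7), (2.10)–(2.11), the normalization (2.8)–(2.9) and the law of
composition (2.12)–(2.14), (2.16)

HONEST FRAMING (lit-balaban, verbatim): statement-level skeleton of published theorems with citation tags; proofs
where landed; nothing here is a claim about the Yang–Mills mass gap.

B1 = T. Bałaban, *(Higgs)₂,₃ quantum fields in a finite volume. I. A lower bound*, Commun. Math. Phys. **85**,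
603–626 (1982) [Balaban1982Higgs1]; held as `paper:balaban1982-cmp85-higgs23-i` (journal page = PDF page + 602);
every quotation below is read from the ×2 page renders `…/pages/1982-cmp85-higgs23-I/…-p006-x2.png`, `…-p007-x2.png`
(pp. 608–609) of the cell `pub-balaban`, not from the OCR layer.  Unit `lit-balaban-r14` (READER/TYPER of B1–B2),
SKELETON rows B1-2.04 … B1-2.16 of `run/shared/lean/pub/lit-balaban/SKELETON.md`.

RELATION TO THE TREE (read first, nothing restated): `…Balaban1983to89.B1` (unit b2b-balaban-pv07) types Props.
2.1–2.3, the sequence `a_k` of (2.13)/(2.15) (`B1.aSeq`; `B1.aSeq_succ` IS the recursion (2.13)), the block-average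
shape of (2.7)/(2.11) (`B1.blockAvg`) and the operator algebra (3.15)/(3.16)/(3.44)/(3.45); `…B1RG242` kernel-checks
the renormalization-group identities (2.41)–(2.43) and the Schur-complement consistency of (2.18)/(2.21) as
finite-dimensional linear algebra.  What no tree module has is the TRANSFORMATION ITSELF — the Gaussian kernel
`t_{a,L,A}` of (2.6)/(2.10), the operator (2.4)–(2.5), its normalization (2.8)–(2.9), and the Gaussian content of the
composition law (2.12) ("An easy Gaussian integration gives the formula") from which (2.14), (2.16) follow.  This
module supplies them; it is imported by nothing yet and modifies nothing.

THE SOURCE TEXT (p. 608 [PDF 6] – p. 609 [PDF 7], verbatim).  *"Now we can define the renormalization transformations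
for scalar fields on a subset Ω of the L^kε-lattice T^{(k)}_{L^kε} satisfying the condition B(Ω′) = Ω.
ρ′(A,ψ) = T^{L^kε}_{a,L,A}[Ω,ρ] = ∫dφ t^{L^kε}_{a,L,A}(Ω;ψ,φ)ρ(A,φ), (2.4)
t^{L^kε}_{a,L,A}(Ω;ψ,φ) = Π_{y∈Ω′} t^{L^kε}_{a,L,A}(ψ(y), φ↾_{B(y)}), (2.5)
t^{L^kε}_{a,L,A}(ψ(y), φ↾_{B(y)}) = (a(L^{k+1}ε)^{d−2}/2π)^{N/2} exp(−½a(L^{k+1}ε)^{d−2}|ψ(y) − (Q(A)φ)(y)|²), (2.6)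
(Q(A)φ)(y) = L^{−d} Σ_{x∈B(y)} U(A(Γ_{y,x}))φ(x). (2.7)
We have the normalization properties ∫dψ(y) t^{L^kε}_{a,L,A}(ψ(y), φ↾_{B(y)}) = 1, (2.8)  ∫dψ ρ′(A,ψ) = ∫dφ ρ(A,φ). (2.9)
… Next let us define a renormalization transformation of k^{th} order T^ε_{a_k,L^k,A} by the formulas (2.4), (2.5),
but instead of (2.6) we take t^ε_{a_k,L^k,A}(ψ(y), φ↾_{B^k(y)}) = (a_k(L^kε)^{d−2}/2π)^{N/2}
exp(−½a_k(L^kε)^{d−2}|ψ(y) − (Q_k(A)φ)(y)|²), y ∈ T^{(k)}_{L^kε}, (2.10) where Q_k(A) is an operator transforming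
functions on the ε-lattice T_ε into functions on the L^kε-lattice T^{(k)}_{L^kε} and given by the formula
(Q_k(A)f)(y) = L^{−kd} Σ_{x∈B^k(y)} U(A(Γ^{(k)}_{y,x}))f(x), y ∈ T^{(k)}_{L^kε}. (2.11)  An easy Gaussian integration
gives the formula ∫ Π_{y∈B(z)} dθ(y) t^{L^kε}_{a,L,A}(ψ(z), θ↾_{B(z)}) Π_{y∈B(z)} t^ε_{a_k,L^k,A}(θ(y), φ↾_{B^k(y)}) =
t^ε_{a_{k+1},L^{k+1},A}(ψ(z), φ↾_{B^{k+1}(z)}), (2.12) where a, a_k, a_{k+1} satisfy the relation a_{k+1} =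
aa_k/(aL^{−2} + a_k). (2.13) From this formula we obtain T^{L^kε}_{a,L,A}T^ε_{a_k,L^k,A} = T^ε_{a_{k+1},L^{k+1},A}. (2.14)
… Thus we get the following formula for the composition of k successive renormalization transformations
T^{L^{k−1}ε}_{a,L,A}·…·T^{Lε}_{a,L,A}T^ε_{a,L,A} = T^ε_{a_k,L^k,A}. (2.16)"*  (p. 605 [PDF 3]: U(A) = exp(qεeA) with q
antisymmetric, *"unitary operators on R^N"*; p. 608: the contour Γ^{(k+1)}_{z,x} = Γ_{z,y} ∪ Γ^{(k)}_{y,x} of (2.2),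
so that U(A(Γ^{(k+1)}_{z,x})) = U(A(Γ_{z,y}))U(A(Γ^{(k)}_{y,x})) for x ∈ B^k(y), y ∈ B(z) — U is a representation of
(R,+) and A(Γ) (2.3) is additive under concatenation of contours.)

WHAT IS TYPED, AND THE DICTIONARY.  `V` ↤ R^N with its Euclidean norm (any finite-dimensional real inner product
space; `Module.finrank ℝ V` ↤ N), with Mathlib's canonical Lebesgue measure `volume` ↤ *"the natural Lebesgue
measure … on the spaces of configurations"* (p. 605); `rtKernel κ v` ↤ the Gaussian single-site kernel
(κ/2π)^{N/2}exp(−½κ|v|²) — (2.6) is `rtKernel (a(L^{k+1}ε)^{d−2}) (ψ(y) − (Q(A)φ)(y))`, (2.10) is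
`rtKernel (a_k(L^kε)^{d−2}) (ψ(y) − (Q_k(A)φ)(y))`; `prec a ℓ d` ↤ the printed precision aℓ^{d−2} (ℓ = L^{k+1}ε with
a, resp. ℓ = L^kε with a_k; integer exponent d − 2, meaningful for every d); `aNext a a_k L` ↤ a_{k+1} of (2.13);
`blockKernel` ↤ the product (2.5) over the block lattice; `rtOp` ↤ the operator (2.4) (integration over all
fine-lattice fields `φ : X → V` against the product Lebesgue measure); the block averages (2.7)/(2.11) are the
tree's `B1.blockAvg` and enter (2.12) as `w • Σ_y u_y(θ y)` with `w` ↤ L^{−d}, `u y` ↤ the orthogonal matrix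
U(A(Γ_{z,y})) (a linear isometry of V), `c y` ↤ (Q_k(A)φ)(y), so that `w • Σ_y u_y (c y)` ↤ (Q_{k+1}(A)φ)(z) by
(2.2)/(2.11).
KERNEL-CHECKED here: (2.8) (`integral_rtKernel_sub`) and its block form (`integral_blockKernel`); (2.9) for any
jointly measurable non-negative kernel with the single-field normalization (`integral_rtOp`, Fubini–Tonelli); the
scalar identity behind (2.13) — composing a precision-α single-site Gaussian with n = L^d independent precision-β
block variables of weight w = L^{−d} gives precision αβ/(β + nw²α), which for the printed α = a(L^{k+1}ε)^{d−2},
β = a_k(L^kε)^{d−2} IS a_{k+1}(L^{k+1}ε)^{d−2} (`prec_comp`, `aNext_eq_aSeq_succ`); and the ONE-SITE Gaussian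
convolution that drives (2.12) (`integral_rtKernel_sub_mul_rtKernel_sub`: ∫dθ t_α(x − θ)t_β(θ − c) =
t_{αβ/(α+β)}(x − c), from the tree's two-Gaussian lemma in `Literature.Analysis.UnboundedOperators`).
KERNEL-CHECKED since v1.1 (was TYPED, proof deferred, in v1.0): the full block identity (2.12) = `Display212` (n
sites, orthogonal transports, any weight w) — `display212`, by the printed "easy Gaussian integration": one Gaussian
integration per site (`integral_rtKernel_sub_smul_mul_rtKernel_sub`, the one-site lemma dressed with the weight
L^{−d} and the transport U(A(Γ_{z,y})) by the change of variables θ ↦ w·U θ, `rtKernel_isometry`, `rtKernel_mul_sq`)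
chained over the sites of B(z) by Fubini–Tonelli (`lintegral_fin_display212`: induction on the number of sites via
`MeasureTheory.measurePreserving_piFinSuccAbove`, the precision recursion `compPrec_succ`; `lintegral_display212`:
transport to an arbitrary finite index type via `MeasureTheory.volume_measurePreserving_piCongrLeft`); (2.14) is
(2.12) read under the integral (2.4) and (2.16) its k-fold iteration — no separate declaration (the operator identity
needs the tower of lattices T^{(j)} of (1.19)–(1.20); SKELETON rows B1-2.14, B1-2.16 point here).  NOT typed here:
the contours (2.1)–(2.2) as lattice paths (only their consequence, the multiplicativity of the transports, is used —
as the shape of the data of `Display212`).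
-/

open scoped BigOperators
open _root_.MeasureTheory _root_.Real

namespace Literature.MathematicalPhysics.QuantumFieldTheory.Balaban1983to89.B1RT

/-! ## (2.6)/(2.10) pp. 608–609: the Gaussian single-site kernel; (2.8); the one-site convolution -/

section KernelDef

variable {V : Type*} [NormedAddCommGroup V] [InnerProductSpace ℝ V]

/-- The single-site kernel of the renormalization transformation: `rtKernel κ v = (κ/2π)^{N/2} exp(−½κ‖v‖²)`,
N = dim V.  (2.6) p. 608 is this kernel at κ = a(L^{k+1}ε)^{d−2}, v = ψ(y) − (Q(A)φ)(y); (2.10) p. 609 at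
κ = a_k(L^kε)^{d−2}, v = ψ(y) − (Q_k(A)φ)(y). [cite: Balaban1982Higgs1, (2.6) p.608, (2.10) p.609] -/
noncomputable def rtKernel (κ : ℝ) (v : V) : ℝ :=
  (κ / (2 * π)) ^ ((Module.finrank ℝ V : ℝ) / 2) * Real.exp (-(κ / 2) * ‖v‖ ^ 2)

/-- Unfolding lemma (definitional). [cite: Balaban1982Higgs1, (2.6) p.608] -/
theorem rtKernel_eq (κ : ℝ) (v : V) :
    rtKernel κ v = (κ / (2 * π)) ^ ((Module.finrank ℝ V : ℝ) / 2) * Real.exp (-(κ / 2) * ‖v‖ ^ 2) := rfl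

/-- The kernel (2.6) is strictly positive for κ > 0 (a Gaussian density). [cite: Balaban1982Higgs1, (2.6) p.608] -/
theorem rtKernel_pos {κ : ℝ} (hκ : 0 < κ) (v : V) : 0 < rtKernel κ v := by
  unfold rtKernel
  have h1 : 0 < (κ / (2 * π)) ^ ((Module.finrank ℝ V : ℝ) / 2) := Real.rpow_pos_of_pos (by positivity) _
  exact mul_pos h1 (Real.exp_pos _)

/-- The kernel (2.6) is non-negative for κ ≥ 0. [cite: Balaban1982Higgs1, (2.6) p.608] -/
theorem rtKernel_nonneg {κ : ℝ} (hκ : 0 ≤ κ) (v : V) : 0 ≤ rtKernel κ v := by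
  unfold rtKernel
  exact mul_nonneg (Real.rpow_nonneg (by positivity) _) (Real.exp_pos _).le

/-- The kernel (2.6) is even: it depends on `v` through `‖v‖` only. [cite: Balaban1982Higgs1, (2.6) p.608] -/
theorem rtKernel_neg (κ : ℝ) (v : V) : rtKernel κ (-v) = rtKernel κ v := by
  simp [rtKernel, norm_neg]

/-- `t(x − θ) = t(θ − x)` (evenness of the kernel (2.6)). [cite: Balaban1982Higgs1, (2.6) p.608] -/
theorem rtKernel_sub_comm (κ : ℝ) (x θ : V) : rtKernel κ (x - θ) = rtKernel κ (θ - x) := by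
  rw [← rtKernel_neg κ (x - θ), neg_sub]

/-- The kernel (2.6) is continuous in `v`. [cite: Balaban1982Higgs1, (2.6) p.608] -/
theorem continuous_rtKernel (κ : ℝ) : Continuous (fun v : V => rtKernel κ v) := by
  unfold rtKernel
  fun_prop

end KernelDef

section Kernel

variable {V : Type*} [NormedAddCommGroup V] [InnerProductSpace ℝ V] [FiniteDimensional ℝ V]
  [MeasurableSpace V] [BorelSpace V]

/-- **(2.8)** p. 609 at m = 0: `∫ (κ/2π)^{N/2} exp(−½κ|ψ|²) dψ = 1` for κ > 0 — Mathlib's Gaussian integral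
`∫ exp(−b‖v‖²) dv = (π/b)^{N/2}` on a finite-dimensional inner product space. KERNEL.
[cite: Balaban1982Higgs1, (2.8) p.609] -/
theorem integral_rtKernel {κ : ℝ} (hκ : 0 < κ) : ∫ v : V, rtKernel κ v = 1 := by
  unfold rtKernel
  rw [integral_const_mul, GaussianFourier.integral_rexp_neg_mul_sq_norm (by positivity : 0 < κ / 2),
    ← Real.mul_rpow (by positivity) (by positivity)]
  have : κ / (2 * π) * (π / (κ / 2)) = 1 := by
    field_simp
  rw [this, Real.one_rpow]

/-- **(2.8)** p. 609, verbatim: *"∫dψ(y) t^{L^kε}_{a,L,A}(ψ(y), φ↾_{B(y)}) = 1"* — the single-site kernel is a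
probability density in ψ(y) whatever the block average m = (Q(A)φ)(y) (translation invariance of Lebesgue measure).
KERNEL. [cite: Balaban1982Higgs1, (2.8) p.609] -/
theorem integral_rtKernel_sub {κ : ℝ} (hκ : 0 < κ) (m : V) : ∫ ψ : V, rtKernel κ (ψ - m) = 1 := by
  rw [integral_sub_right_eq_self (μ := (volume : Measure V)) (fun v => rtKernel κ v) m]
  exact integral_rtKernel hκ

/-- Integrability of the translated kernel (2.6) in ψ(y) (it has integral (2.8) = 1 ≠ 0). [cite: Balaban1982Higgs1, (2.8) p.609] -/
theorem integrable_rtKernel_sub {κ : ℝ} (hκ : 0 < κ) (m : V) :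
    Integrable (fun ψ : V => rtKernel κ (ψ - m)) := by
  refine Integrable.of_integral_ne_zero ?_
  rw [integral_rtKernel_sub hκ m]
  exact one_ne_zero

/-- The ONE-SITE Gaussian convolution behind (2.12) (*"An easy Gaussian integration"*): integrating a precision-α
kernel in the difference x − θ against a precision-β kernel in θ − c gives the precision-αβ/(α + β) kernel in
x − c (variances add: 1/γ = 1/α + 1/β).  KERNEL, from the tree's two-Gaussian lemma
`Literature.Analysis.UnboundedOperators.integral_rexp_neg_mul_sq_norm_mul_rexp_neg_mul_sq_norm_sub`.
[cite: Balaban1982Higgs1, (2.12) p.609] -/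
theorem integral_rtKernel_sub_mul_rtKernel_sub {α β : ℝ} (hα : 0 < α) (hβ : 0 < β) (x c : V) :
    ∫ θ : V, rtKernel α (x - θ) * rtKernel β (θ - c) = rtKernel (α * β / (α + β)) (x - c) := by
  have h1 : ∫ θ : V, rtKernel α (x - θ) * rtKernel β (θ - c)
      = ∫ y : V, rtKernel α ((x - c) - y) * rtKernel β y := by
    rw [← integral_add_right_eq_self (μ := (volume : Measure V))
      (fun θ => rtKernel α (x - θ) * rtKernel β (θ - c)) c]
    congr 1
    funext y
    rw [add_sub_cancel_right, sub_add_eq_sub_sub, sub_right_comm]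
  rw [h1]
  set r : ℝ := (Module.finrank ℝ V : ℝ) / 2 with hr
  have h2 : ∀ y : V, rtKernel α ((x - c) - y) * rtKernel β y
      = (α / (2 * π)) ^ r * (β / (2 * π)) ^ r *
          (Real.exp (-(β / 2) * ‖y‖ ^ 2) * Real.exp (-(α / 2) * ‖(x - c) - y‖ ^ 2)) := by
    intro y
    simp only [rtKernel, ← hr]
    ring
  simp_rw [h2]
  rw [integral_const_mul,
    Literature.Analysis.UnboundedOperators.integral_rexp_neg_mul_sq_norm_mul_rexp_neg_mul_sq_norm_sub
      (by positivity : 0 < β / 2) (by positivity : 0 < α / 2) (x - c)]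
  simp only [rtKernel, ← hr]
  have hαβ : 0 < α + β := add_pos hα hβ
  have e1 : β / 2 * (α / 2) / (β / 2 + α / 2) = α * β / (α + β) / 2 := by
    field_simp
    ring
  have e2 : (α / (2 * π)) ^ r * (β / (2 * π)) ^ r * (π / (β / 2 + α / 2)) ^ r
      = (α * β / (α + β) / (2 * π)) ^ r := by
    rw [← Real.mul_rpow (by positivity) (by positivity), ← Real.mul_rpow (by positivity) (by positivity)]
    congr 1
    field_simp
    ring
  rw [e1, ← mul_assoc, e2]

end Kernel

/-! ## (2.13) p. 609: the printed precisions and their composition -/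

section Scalars

/-- The printed precision `aℓ^{d−2}` of (2.6)/(2.10) (ℓ = L^{k+1}ε with the constant a, resp. ℓ = L^kε with a_k);
integer exponent d − 2 (d = 2, 3 in the paper: exponent 0, 1). [cite: Balaban1982Higgs1, (2.6) p.608, (2.10) p.609] -/
noncomputable def prec (a ℓ : ℝ) (d : ℕ) : ℝ := a * ℓ ^ ((d : ℤ) - 2)

/-- Unfolding lemma (definitional). [cite: Balaban1982Higgs1, (2.6) p.608] -/
theorem prec_eq (a ℓ : ℝ) (d : ℕ) : prec a ℓ d = a * ℓ ^ ((d : ℤ) - 2) := rfl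

/-- The printed precision aℓ^{d−2} of (2.6)/(2.10) is positive for a, ℓ > 0. [cite: Balaban1982Higgs1, (2.6) p.608] -/
theorem prec_pos {a ℓ : ℝ} (ha : 0 < a) (hℓ : 0 < ℓ) (d : ℕ) : 0 < prec a ℓ d :=
  mul_pos ha (zpow_pos hℓ _)

/-- **(2.13)** p. 609, verbatim: *"where a, a_k, a_{k+1} satisfy the relation a_{k+1} = aa_k/(aL^{−2} + a_k)"*.
[cite: Balaban1982Higgs1, (2.13) p.609] -/
noncomputable def aNext (a ak L : ℝ) : ℝ := a * ak / (a * (L ^ 2)⁻¹ + ak)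

/-- Unfolding lemma (definitional). [cite: Balaban1982Higgs1, (2.13) p.609] -/
theorem aNext_eq (a ak L : ℝ) : aNext a ak L = a * ak / (a * (L ^ 2)⁻¹ + ak) := rfl

/-- (2.13) IS the recursion satisfied by the tree's closed form (2.15) `B1.aSeq`: a_{k+1} = aNext a a_k L for k ≥ 1.
KERNEL (= `B1.aSeq_succ`). [cite: Balaban1982Higgs1, (2.13)/(2.15) p.609] -/
theorem aNext_eq_aSeq_succ {a L : ℝ} (ha : 0 < a) (hL : 1 < L) {k : ℕ} (hk : 1 ≤ k) :
    aNext a (B1.aSeq a L k) L = B1.aSeq a L (k + 1) := by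
  rw [aNext_eq, B1.aSeq_succ ha hL hk]

/-- a_{k+1} > 0 for a, a_k > 0. [cite: Balaban1982Higgs1, (2.13) p.609] -/
theorem aNext_pos {a ak L : ℝ} (ha : 0 < a) (hak : 0 < ak) : 0 < aNext a ak L := by
  unfold aNext
  positivity

/-- Precision bookkeeping of one composition step: a precision-α Gaussian in ψ(z) − wΣ_yU_yθ(y), integrated against
n independent precision-β Gaussians in the θ(y), is a precision-γ Gaussian with 1/γ = 1/α + nw²/β, i.e.
γ = αβ/(β + nw²α) (one application of `integral_rtKernel_sub_mul_rtKernel_sub` per site, each adding w²/β to the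
variance).  This names γ; it is the precision appearing on the right side of `Display212`, and for the printed data it
is a_{k+1}(L^{k+1}ε)^{d−2} (`prec_comp`). [cite: Balaban1982Higgs1, (2.12)–(2.13) p.609] -/
noncomputable def compPrec (α β w : ℝ) (n : ℕ) : ℝ := α * β / (β + n * w ^ 2 * α)

/-- Unfolding lemma (definitional). [cite: Balaban1982Higgs1, (2.12)–(2.13) p.609] -/
theorem compPrec_eq (α β w : ℝ) (n : ℕ) : compPrec α β w n = α * β / (β + n * w ^ 2 * α) := rfl

/-- With no block variable (n = 0) nothing is integrated and the precision is unchanged (consistency of the typed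
(2.12) in the degenerate case). [cite: Balaban1982Higgs1, (2.12) p.609] -/
theorem compPrec_zero (α β w : ℝ) (hβ : β ≠ 0) : compPrec α β w 0 = α := by
  simp [compPrec_eq, mul_div_assoc, div_self hβ]

/-- One block variable of weight 1: γ = αβ/(α + β), the precision of `integral_rtKernel_sub_mul_rtKernel_sub` (the
one-site case of (2.12)). [cite: Balaban1982Higgs1, (2.12) p.609] -/
theorem compPrec_one (α β : ℝ) : compPrec α β 1 1 = α * β / (α + β) := by
  simp [compPrec_eq, add_comm]

/-- **The scalar content of (2.12)–(2.13)** p. 609, KERNEL: with the printed data — α = a(L^{k+1}ε)^{d−2} (2.6),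
β = a_k(L^kε)^{d−2} (2.10), n = L^d sites in the block B(z) and weight w = L^{−d} in (2.7) — the composed precision
is γ = a_{k+1}(L^{k+1}ε)^{d−2} with a_{k+1} = aa_k/(aL^{−2} + a_k) (2.13).  Here ℓ ↤ L^kε > 0 (so L^{k+1}ε = Lℓ) and
the block size L is a positive natural number. [cite: Balaban1982Higgs1, (2.12)–(2.13) p.609] -/
theorem prec_comp {a ak ℓ : ℝ} {L d : ℕ} (ha : 0 < a) (hak : 0 < ak) (hL : 0 < L) (hℓ : 0 < ℓ) :
    compPrec (prec a (L * ℓ) d) (prec ak ℓ d) (((L : ℝ) ^ d)⁻¹) (L ^ d) = prec (aNext a ak L) (L * ℓ) d := by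
  have hL' : (0 : ℝ) < L := by exact_mod_cast hL
  have hs : 0 < ℓ ^ ((d : ℤ) - 2) := zpow_pos hℓ _
  have ht : ((L : ℝ) * ℓ) ^ ((d : ℤ) - 2) = (L : ℝ) ^ d * ((L : ℝ) ^ 2)⁻¹ * ℓ ^ ((d : ℤ) - 2) := by
    rw [mul_zpow, zpow_sub₀ hL'.ne', zpow_natCast, div_eq_mul_inv]
    norm_cast
  simp only [compPrec_eq, prec_eq, aNext_eq, ht, Nat.cast_pow]
  field_simp
  ring

end Scalars

/-! ## (2.4)–(2.5) p. 608: the transformation as an integral operator; (2.8) for blocks; (2.9) -/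

section BlockKernel

variable {V : Type*} [NormedAddCommGroup V] [InnerProductSpace ℝ V]
variable {X Y : Type*} [Fintype Y]

/-- **(2.5)** p. 608: the block kernel `t(Ω;ψ,φ) = Π_{y∈Ω′} t(ψ(y), φ↾_{B(y)})` — DICTIONARY: `Y` ↤ the block lattice
Ω′ (resp. T^{(k)}_{L^kε} for (2.10)), `X` ↤ the fine lattice Ω, `κ` ↤ the precision a(L^{k+1}ε)^{d−2} (resp.
a_k(L^kε)^{d−2}), `m φ y` ↤ the block average (Q(A)φ)(y) of (2.7) (resp. (Q_k(A)φ)(y) of (2.11); any function of the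
fine field — the tree's `B1.blockAvg` is the printed one). [cite: Balaban1982Higgs1, (2.5)–(2.6) p.608, (2.10) p.609] -/
noncomputable def blockKernel (κ : ℝ) (m : (X → V) → Y → V) (ψ : Y → V) (φ : X → V) : ℝ :=
  ∏ y, rtKernel κ (ψ y - m φ y)

/-- Unfolding lemma (definitional). [cite: Balaban1982Higgs1, (2.5) p.608] -/
theorem blockKernel_eq (κ : ℝ) (m : (X → V) → Y → V) (ψ : Y → V) (φ : X → V) :
    blockKernel κ m ψ φ = ∏ y, rtKernel κ (ψ y - m φ y) := rfl

/-- The block kernel (2.5) is non-negative. [cite: Balaban1982Higgs1, (2.5) p.608] -/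
theorem blockKernel_nonneg {κ : ℝ} (hκ : 0 ≤ κ) (m : (X → V) → Y → V) (ψ : Y → V) (φ : X → V) :
    0 ≤ blockKernel κ m ψ φ :=
  Finset.prod_nonneg fun _ _ => rtKernel_nonneg hκ _

end BlockKernel

section Operator

variable {V : Type*} [NormedAddCommGroup V] [InnerProductSpace ℝ V] [FiniteDimensional ℝ V]
  [MeasurableSpace V] [BorelSpace V]
variable {X Y : Type*} [Fintype X]

/-- **(2.4)** p. 608: the renormalization transformation as an integral operator on densities,
`(Tρ)(ψ) = ∫dφ t(ψ,φ)ρ(φ)` — DICTIONARY: `ρ` ↤ the density ρ(A,·) of the fine fields φ : X → V (X ↤ Ω), `ψ : Y → V`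
↤ the block field on Ω′, `t` ↤ the kernel (2.5) (`blockKernel`), the integral ↤ ∫dφ = product Lebesgue measure
over the sites of Ω. Generic in the kernel. [cite: Balaban1982Higgs1, (2.4) p.608] -/
noncomputable def rtOp (t : (Y → V) → (X → V) → ℝ) (ρ : (X → V) → ℝ) (ψ : Y → V) : ℝ :=
  ∫ φ, t ψ φ * ρ φ

/-- Unfolding lemma (definitional). [cite: Balaban1982Higgs1, (2.4) p.608] -/
theorem rtOp_eq (t : (Y → V) → (X → V) → ℝ) (ρ : (X → V) → ℝ) (ψ : Y → V) :
    rtOp t ρ ψ = ∫ φ, t ψ φ * ρ φ := rfl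

variable [Fintype Y]

omit [Fintype X] in
/-- **(2.8) for the block kernel (2.5)**: `∫dψ Π_{y∈Ω′} t(ψ(y), φ↾_{B(y)}) = 1` — the product of the single-site
normalizations (2.8) over y ∈ Ω′ (Fubini for product integrands). KERNEL. [cite: Balaban1982Higgs1, (2.5), (2.8) pp.608–609] -/
theorem integral_blockKernel {κ : ℝ} (hκ : 0 < κ) (m : (X → V) → Y → V) (φ : X → V) :
    ∫ ψ : Y → V, blockKernel κ m ψ φ = 1 := by
  have h := integral_fintype_prod_volume_eq_prod (𝕜 := ℝ) (fun y (v : V) => rtKernel κ (v - m φ y))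
  simp only [integral_rtKernel_sub hκ, Finset.prod_const_one] at h
  simpa [blockKernel] using h

/-- **(2.9)** p. 609, verbatim: *"∫dψ ρ′(A,ψ) = ∫dφ ρ(A,φ)"* — the transformation preserves the integral of the
density.  KERNEL for every jointly measurable non-negative kernel `t` with the single-field normalization
`∫dψ t(ψ,φ) = 1` (for the kernel (2.5) this is `integral_blockKernel`) and every integrable density ρ: Tonelli
gives the integrability of (ψ,φ) ↦ t(ψ,φ)ρ(φ), Fubini exchanges the integrals. [cite: Balaban1982Higgs1, (2.9) p.609] -/
theorem integral_rtOp {t : (Y → V) → (X → V) → ℝ} (ht : Measurable (Function.uncurry t))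
    (hpos : ∀ ψ φ, 0 ≤ t ψ φ) (hnorm : ∀ φ, ∫ ψ, t ψ φ = 1) {ρ : (X → V) → ℝ} (hρ : Integrable ρ) :
    ∫ ψ, rtOp t ρ ψ = ∫ φ, ρ φ := by
  simp only [rtOp_eq]
  have hmeas : AEStronglyMeasurable (Function.uncurry fun ψ φ => t ψ φ * ρ φ)
      ((volume : Measure (Y → V)).prod (volume : Measure (X → V))) := by
    have h1 : AEStronglyMeasurable (Function.uncurry t)
        ((volume : Measure (Y → V)).prod (volume : Measure (X → V))) := ht.aestronglyMeasurable
    have h2 : AEStronglyMeasurable (fun z : (Y → V) × (X → V) => ρ z.2)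
        ((volume : Measure (Y → V)).prod (volume : Measure (X → V))) := hρ.1.comp_snd
    exact h1.mul h2
  have hint : Integrable (Function.uncurry fun ψ φ => t ψ φ * ρ φ)
      ((volume : Measure (Y → V)).prod (volume : Measure (X → V))) := by
    rw [integrable_prod_iff' hmeas]
    refine ⟨Filter.Eventually.of_forall fun φ => ?_, ?_⟩
    · have hi : Integrable (fun ψ : Y → V => t ψ φ) := by
        refine Integrable.of_integral_ne_zero ?_
        rw [hnorm φ]
        exact one_ne_zero
      simpa [Function.uncurry] using hi.mul_const (ρ φ)
    · have hpt : ∀ φ : X → V, ∫ ψ : Y → V, ‖Function.uncurry (fun ψ φ => t ψ φ * ρ φ) (ψ, φ)‖ = ‖ρ φ‖ := by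
        intro φ
        have : ∀ ψ : Y → V, ‖Function.uncurry (fun ψ φ => t ψ φ * ρ φ) (ψ, φ)‖ = t ψ φ * ‖ρ φ‖ := by
          intro ψ
          simp only [Function.uncurry_apply_pair, norm_mul, Real.norm_of_nonneg (hpos ψ φ)]
        simp_rw [this]
        rw [integral_mul_const, hnorm φ, one_mul]
      simp_rw [hpt]
      exact hρ.norm
  rw [integral_integral_swap hint]
  refine integral_congr_ae (Filter.Eventually.of_forall fun φ => ?_)
  simp only
  rw [integral_mul_const, hnorm φ, one_mul]

/-- (2.9) for the Gaussian kernel (2.5)/(2.6) with a continuous block-average map (e.g. the linear `B1.blockAvg`):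
`∫dψ (T_{a,L,A}ρ)(ψ) = ∫dφ ρ(φ)` for every integrable ρ. KERNEL. [cite: Balaban1982Higgs1, (2.9) p.609] -/
theorem integral_rtOp_blockKernel {κ : ℝ} (hκ : 0 < κ) {m : (X → V) → Y → V} (hm : Continuous m)
    {ρ : (X → V) → ℝ} (hρ : Integrable ρ) :
    ∫ ψ, rtOp (blockKernel κ m) ρ ψ = ∫ φ, ρ φ := by
  refine integral_rtOp ?_ (fun ψ φ => blockKernel_nonneg hκ.le m ψ φ) (integral_blockKernel hκ m) hρ
  have hc : Continuous (Function.uncurry (blockKernel (X := X) (Y := Y) κ m)) := by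
    unfold blockKernel Function.uncurry
    refine continuous_finsetProd _ fun y _ => ?_
    exact (continuous_rtKernel κ).comp
      (((continuous_apply y).comp continuous_fst).sub ((continuous_apply y).comp (hm.comp continuous_snd)))
  exact hc.measurable

end Operator

/-! ## (2.12) p. 609: the composition identity, TYPED here and PROVED below (`display212`, v1.1) -/

section Composition

variable (ι : Type*) [Fintype ι] (V : Type*) [NormedAddCommGroup V] [InnerProductSpace ℝ V]
  [FiniteDimensional ℝ V] [MeasurableSpace V] [BorelSpace V]

/-- **(2.12)** p. 609 (*"An easy Gaussian integration gives the formula"*), TYPED over one block: DICTIONARY `ι` ↤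
the sites y of the block B(z) (n = |ι| = L^d of them), `θ : ι → V` ↤ the block field θ↾_{B(z)} integrated out,
`α` ↤ a(L^{k+1}ε)^{d−2} (precision of t^{L^kε}_{a,L,A}, (2.6)), `β` ↤ a_k(L^kε)^{d−2} (precision of t^ε_{a_k,L^k,A},
(2.10)), `w` ↤ L^{−d} (the weight of (2.7)), `u y` ↤ U(A(Γ_{z,y})) (orthogonal: U is a unitary representation on
R^N, p. 605), `c y` ↤ (Q_k(A)φ)(y), so that `w • Σ_y u_y(θ y)` ↤ (Q(A)θ)(z) and, by the concatenation (2.2) of the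
contours, `w • Σ_y u_y(c y)` ↤ (Q_{k+1}(A)φ)(z); the right side is t^ε_{a_{k+1},L^{k+1},A}(ψ(z), φ↾_{B^{k+1}(z)})
because `compPrec α β w n` = a_{k+1}(L^{k+1}ε)^{d−2} for these data (`prec_comp`).  The typed statement is the
general Gaussian fact (any n, w, isometries u_y); its proof — `integral_rtKernel_sub_mul_rtKernel_sub` once per
site, by Fubini over `ι → V` — is `display212` below (v1.1; for α, β > 0).
[cite: Balaban1982Higgs1, (2.12) p.609] -/
def Display212 (α β w : ℝ) (u : ι → (V ≃ₗᵢ[ℝ] V)) (c : ι → V) (ψ : V) : Prop :=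
  ∫ θ : ι → V, rtKernel α (ψ - w • ∑ y, u y (θ y)) * ∏ y, rtKernel β (θ y - c y)
    = rtKernel (compPrec α β w (Fintype.card ι)) (ψ - w • ∑ y, u y (c y))

/-- Unfolding lemma (definitional). [cite: Balaban1982Higgs1, (2.12) p.609] -/
theorem display212_iff (α β w : ℝ) (u : ι → (V ≃ₗᵢ[ℝ] V)) (c : ι → V) (ψ : V) :
    Display212 ι V α β w u c ψ ↔
      ∫ θ : ι → V, rtKernel α (ψ - w • ∑ y, u y (θ y)) * ∏ y, rtKernel β (θ y - c y)
        = rtKernel (compPrec α β w (Fintype.card ι)) (ψ - w • ∑ y, u y (c y)) :=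
  Iff.rfl

end Composition

/-! ## (2.12) p. 609 — PROOF (v1.1, lit-balaban-r14 gen 2): *"An easy Gaussian integration gives the formula"*

The printed proof, formalized: (a) the kernel (2.6) sees the transports U(A(Γ)) only through the norm and rescales
under θ ↦ wθ (`rtKernel_isometry`, `rtKernel_mul_sq`); (b) ONE site: ∫dθ t_γ(x − wUθ)t_β(θ − c) = t_{γβ/(β+w²γ)}(x − wUc)
(`integral_rtKernel_sub_smul_mul_rtKernel_sub`, from the v1.0 one-site convolution by the substitutions θ ↦ Uθ,
θ ↦ wθ); (c) n sites: integrate the sites of B(z) one at a time (Fubini–Tonelli along `Fin.cons`), the precision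
obeying γ_{j+1} = γ_jβ/(β + w²γ_j), γ_0 = α, whose solution is `compPrec α β w n` (`compPrec_succ`,
`lintegral_fin_display212`), then transport from `Fin n` to the block's own index type (`lintegral_display212`) and
from `∫⁻` back to the Bochner integral (`display212`). -/

open scoped ENNReal

section KernelMore

variable {V : Type*} [NormedAddCommGroup V] [InnerProductSpace ℝ V]

/-- The kernel (2.6) depends on `v` only through `‖v‖`. [cite: Balaban1982Higgs1, (2.6) p.608] -/
theorem rtKernel_congr_norm (κ : ℝ) {v v' : V} (h : ‖v‖ = ‖v'‖) : rtKernel κ v = rtKernel κ v' := by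
  simp only [rtKernel, h]

/-- The kernel (2.6) is invariant under the isometric parallel transports U(A(Γ)) (p. 605: *"unitary
operators on R^N"*). [cite: Balaban1982Higgs1, (2.6)–(2.7) p.608] -/
theorem rtKernel_isometry (κ : ℝ) (u : V ≃ₗᵢ[ℝ] V) (v : V) : rtKernel κ (u v) = rtKernel κ v :=
  rtKernel_congr_norm κ (u.norm_map v)

/-- Scaling of the kernel (2.6): `t_{κs²}(v) = |s|^N t_κ(s•v)` for κ ≥ 0. [cite: Balaban1982Higgs1, (2.6) p.608] -/
theorem rtKernel_mul_sq {κ : ℝ} (hκ : 0 ≤ κ) (s : ℝ) (v : V) :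
    rtKernel (κ * s ^ 2) v = |s| ^ Module.finrank ℝ V * rtKernel κ (s • v) := by
  unfold rtKernel
  rw [norm_smul, Real.norm_eq_abs, mul_pow, sq_abs]
  have h2 : (s ^ 2 : ℝ) ^ ((Module.finrank ℝ V : ℝ) / 2) = |s| ^ Module.finrank ℝ V := by
    rw [← sq_abs, ← Real.rpow_natCast |s| 2, ← Real.rpow_mul (abs_nonneg s),
      ← Real.rpow_natCast |s| (Module.finrank ℝ V)]
    congr 1
    push_cast
    ring
  have h1 : (κ * s ^ 2 / (2 * π)) ^ ((Module.finrank ℝ V : ℝ) / 2)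
      = |s| ^ Module.finrank ℝ V * (κ / (2 * π)) ^ ((Module.finrank ℝ V : ℝ) / 2) := by
    rw [show κ * s ^ 2 / (2 * π) = s ^ 2 * (κ / (2 * π)) by ring,
      Real.mul_rpow (sq_nonneg s) (by positivity), h2]
  rw [h1, mul_assoc]
  congr 2
  ring_nf

end KernelMore

section OneSite

variable {V : Type*} [NormedAddCommGroup V] [InnerProductSpace ℝ V] [FiniteDimensional ℝ V]
  [MeasurableSpace V] [BorelSpace V]

/-- The one-site convolution with a weight and an isometric transport:
`∫dθ t_γ(x − w•uθ) t_β(θ − c) = t_{γβ/(β + w²γ)}(x − w•uc)`. [cite: Balaban1982Higgs1, (2.12) p.609] -/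
theorem integral_rtKernel_sub_smul_mul_rtKernel_sub {γ β : ℝ} (hγ : 0 < γ) (hβ : 0 < β) (w : ℝ)
    (u : V ≃ₗᵢ[ℝ] V) (x c : V) :
    ∫ θ : V, rtKernel γ (x - w • u θ) * rtKernel β (θ - c)
      = rtKernel (γ * β / (β + w ^ 2 * γ)) (x - w • u c) := by
  rcases eq_or_ne w 0 with rfl | hw
  · simp only [zero_smul, sub_zero, zero_pow two_ne_zero, zero_mul, add_zero]
    rw [integral_const_mul, integral_rtKernel_sub hβ, mul_one, mul_div_assoc, div_self hβ.ne', mul_one]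
  -- step (i): θ ↦ uθ (measure preserving)
  have hme : MeasurableEmbedding (u : V → V) := u.toContinuousLinearEquiv.toHomeomorph.measurableEmbedding
  have h1 : ∫ θ : V, rtKernel γ (x - w • u θ) * rtKernel β (θ - c)
      = ∫ θ' : V, rtKernel γ (x - w • θ') * rtKernel β (θ' - u c) := by
    have hc := u.measurePreserving.integral_comp hme
      (fun θ' => rtKernel γ (x - w • θ') * rtKernel β (θ' - u c))
    rw [← hc]
    congr 1
    funext θ
    rw [← map_sub, rtKernel_isometry]
  -- step (ii): θ' ↦ w•θ'
  set g : V → ℝ := fun z => rtKernel γ (x - z) * rtKernel β (w⁻¹ • z - u c) with hg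
  have h2 : ∫ θ' : V, rtKernel γ (x - w • θ') * rtKernel β (θ' - u c) = ∫ θ' : V, g (w • θ') := by
    congr 1
    funext θ'
    simp only [hg, inv_smul_smul₀ hw]
  have h3 : ∫ θ' : V, g (w • θ') = |(w ^ Module.finrank ℝ V)⁻¹| • ∫ z, g z :=
    Measure.integral_comp_smul volume g w
  have hβ' : 0 < β / w ^ 2 := div_pos hβ (by positivity)
  have h4 : ∀ z : V, g z = |w| ^ Module.finrank ℝ V *
      (rtKernel γ (x - z) * rtKernel (β / w ^ 2) (z - w • u c)) := by
    intro z
    simp only [hg]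
    have e1 : w⁻¹ • z - u c = w⁻¹ • (z - w • u c) := by rw [smul_sub, inv_smul_smul₀ hw]
    have e3 := rtKernel_mul_sq hβ.le w⁻¹ (z - w • u c)
    have e4 : rtKernel β (w⁻¹ • (z - w • u c))
        = |w| ^ Module.finrank ℝ V * rtKernel (β / w ^ 2) (z - w • u c) := by
      rw [show β / w ^ 2 = β * w⁻¹ ^ 2 by rw [inv_pow, div_eq_mul_inv], e3, ← mul_assoc,
        abs_inv, inv_pow, mul_inv_cancel₀ (pow_ne_zero _ (abs_ne_zero.mpr hw)), one_mul]
    rw [e1, e4]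
    ring
  have h5 : ∫ z, g z = |w| ^ Module.finrank ℝ V *
      rtKernel (γ * (β / w ^ 2) / (γ + β / w ^ 2)) (x - w • u c) := by
    simp_rw [h4]
    rw [integral_const_mul, integral_rtKernel_sub_mul_rtKernel_sub hγ hβ' x (w • u c)]
  have h6 : γ * (β / w ^ 2) / (γ + β / w ^ 2) = γ * β / (β + w ^ 2 * γ) := by
    field_simp
    ring
  rw [h1, h2, h3, h5, h6, smul_eq_mul, ← mul_assoc, abs_inv, abs_pow,
    inv_mul_cancel₀ (pow_ne_zero _ (abs_ne_zero.mpr hw)), one_mul]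

end OneSite

/-! ## (2.12): the n-site composition — Tonelli induction over the sites of the block -/

section Composition2

/-- The composed precision is positive for α, β > 0. [cite: Balaban1982Higgs1, (2.12)–(2.13) p.609] -/
theorem compPrec_pos {α β : ℝ} (hα : 0 < α) (hβ : 0 < β) (w : ℝ) (n : ℕ) : 0 < compPrec α β w n := by
  unfold compPrec
  positivity

/-- One more site: `γ_{n+1} = γ_nβ/(β + w²γ_n)` (the precision recursion behind the induction over the sites
of B(z); for n = L^d it is (2.13)). [cite: Balaban1982Higgs1, (2.12)–(2.13) p.609] -/
theorem compPrec_succ {α β : ℝ} (hα : 0 < α) (hβ : 0 < β) (w : ℝ) (n : ℕ) :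
    compPrec α β w (n + 1) = compPrec α β w n * β / (β + w ^ 2 * compPrec α β w n) := by
  have hD : 0 < β + n * w ^ 2 * α := by positivity
  unfold compPrec
  push_cast
  field_simp
  ring

variable {V : Type*} [NormedAddCommGroup V] [InnerProductSpace ℝ V] [FiniteDimensional ℝ V]
  [MeasurableSpace V] [BorelSpace V]

omit [FiniteDimensional ℝ V] [MeasurableSpace V] [BorelSpace V] in
/-- Continuity of the (2.12) integrand in the block field θ. [cite: Balaban1982Higgs1, (2.12) p.609] -/
theorem continuous_integrand212 {ι : Type*} [Fintype ι] (α β w : ℝ) (u : ι → (V ≃ₗᵢ[ℝ] V)) (c : ι → V)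
    (ψ : V) : Continuous fun θ : ι → V =>
      rtKernel α (ψ - w • ∑ y, u y (θ y)) * ∏ y, rtKernel β (θ y - c y) := by
  refine Continuous.mul ?_ ?_
  · refine (continuous_rtKernel α).comp (continuous_const.sub (continuous_const.smul ?_))
    exact continuous_finsetSum _ fun y _ => (u y).continuous.comp (continuous_apply y)
  · exact continuous_finsetProd _ fun y _ => (continuous_rtKernel β).comp ((continuous_apply y).sub continuous_const)

omit [FiniteDimensional ℝ V] [MeasurableSpace V] [BorelSpace V] in
/-- The (2.12) integrand is non-negative. [cite: Balaban1982Higgs1, (2.12) p.609] -/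
theorem integrand212_nonneg {ι : Type*} [Fintype ι] {α β : ℝ} (hα : 0 ≤ α) (hβ : 0 ≤ β) (w : ℝ)
    (u : ι → (V ≃ₗᵢ[ℝ] V)) (c : ι → V) (ψ : V) (θ : ι → V) :
    0 ≤ rtKernel α (ψ - w • ∑ y, u y (θ y)) * ∏ y, rtKernel β (θ y - c y) :=
  mul_nonneg (rtKernel_nonneg hα _) (Finset.prod_nonneg fun _ _ => rtKernel_nonneg hβ _)

/-- (2.12) over the sites `Fin n`, in Tonelli (`∫⁻`) form: induction on n, integrating out the first site last
(`measurePreserving_piFinSuccAbove`), the inner n sites by the induction hypothesis and the last one by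
`integral_rtKernel_sub_smul_mul_rtKernel_sub`. [cite: Balaban1982Higgs1, (2.12) p.609] -/
theorem lintegral_fin_display212 {α β : ℝ} (hα : 0 < α) (hβ : 0 < β) (w : ℝ) :
    ∀ (n : ℕ) (u : Fin n → (V ≃ₗᵢ[ℝ] V)) (c : Fin n → V) (ψ : V),
      ∫⁻ θ : Fin n → V, ENNReal.ofReal (rtKernel α (ψ - w • ∑ i, u i (θ i)) * ∏ i, rtKernel β (θ i - c i))
        = ENNReal.ofReal (rtKernel (compPrec α β w n) (ψ - w • ∑ i, u i (c i))) := by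
  intro n
  induction n with
  | zero =>
    intro u c ψ
    simp only [Finset.univ_eq_empty, Finset.sum_empty, Finset.prod_empty, smul_zero, sub_zero, mul_one,
      lintegral_const, compPrec_zero α β w hβ.ne']
    rw [volume_pi, Measure.pi_univ, Finset.univ_eq_empty, Finset.prod_empty, mul_one]
  | succ n ih =>
    intro u c ψ
    -- the integrand and its transport along `Fin.cons`
    set F : (Fin (n + 1) → V) → ℝ≥0∞ := fun θ =>
      ENNReal.ofReal (rtKernel α (ψ - w • ∑ i, u i (θ i)) * ∏ i, rtKernel β (θ i - c i)) with hF
    have hFm : Measurable F :=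
      (continuous_integrand212 α β w u c ψ).measurable.ennreal_ofReal
    set e := MeasurableEquiv.piFinSuccAbove (fun _ : Fin (n + 1) => V) 0 with he_def
    have hmp := (measurePreserving_piFinSuccAbove (fun _ : Fin (n + 1) => (volume : Measure V)) 0).symm
    have he : ∀ p : V × (Fin n → V), e.symm p = Fin.cons p.1 p.2 := by
      intro p
      simp only [he_def, MeasurableEquiv.piFinSuccAbove_symm_apply, Fin.insertNthEquiv, Fin.insertNth_zero,
        Equiv.coe_fn_mk]
      rfl
    -- the value of F on `Fin.cons x r`
    set u' : Fin n → (V ≃ₗᵢ[ℝ] V) := fun j => u j.succ with hu'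
    set c' : Fin n → V := fun j => c j.succ with hc'
    have hcons : ∀ (x : V) (r : Fin n → V), F (Fin.cons x r)
        = ENNReal.ofReal (rtKernel β (x - c 0)) *
          ENNReal.ofReal (rtKernel α ((ψ - w • u 0 x) - w • ∑ j, u' j (r j)) *
            ∏ j, rtKernel β (r j - c' j)) := by
      intro x r
      rw [hF]
      dsimp only
      rw [Fin.sum_univ_succ, Fin.prod_univ_succ]
      simp only [Fin.cons_zero, Fin.cons_succ, hu', hc']
      rw [← ENNReal.ofReal_mul (rtKernel_nonneg hβ.le _)]
      congr 1
      rw [smul_add, sub_sub]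
      ring
    -- change of variables + Tonelli
    have h1 : ∫⁻ θ, F θ ∂(Measure.pi fun _ : Fin (n + 1) => (volume : Measure V))
        = ∫⁻ p, F (e.symm p) ∂((volume : Measure V).prod (Measure.pi fun _ : Fin n => volume)) :=
      (hmp.lintegral_comp_emb e.symm.measurableEmbedding F).symm
    have h2 : ∫⁻ p, F (e.symm p) ∂((volume : Measure V).prod (Measure.pi fun _ : Fin n => volume))
        = ∫⁻ x, ∫⁻ r, F (e.symm (x, r)) ∂(Measure.pi fun _ : Fin n => volume) ∂(volume : Measure V) :=
      lintegral_prod _ (hFm.comp e.symm.measurable).aemeasurable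
    -- the inner integral by the induction hypothesis
    have h3 : ∀ x : V, ∫⁻ r, F (e.symm (x, r)) ∂(Measure.pi fun _ : Fin n => volume)
        = ENNReal.ofReal (rtKernel β (x - c 0)) *
          ENNReal.ofReal (rtKernel (compPrec α β w n) ((ψ - w • u 0 x) - w • ∑ j, u' j (c' j))) := by
      intro x
      have hih := ih u' c' (ψ - w • u 0 x)
      rw [volume_pi] at hih
      simp_rw [he, hcons]
      rw [lintegral_const_mul' _ _ ENNReal.ofReal_ne_top, hih]
    -- the last site
    have hγ := compPrec_pos hα hβ w n
    set x'' : V := ψ - w • ∑ j, u' j (c' j) with hx''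
    have h4 : ∀ x : V, ENNReal.ofReal (rtKernel β (x - c 0)) *
          ENNReal.ofReal (rtKernel (compPrec α β w n) ((ψ - w • u 0 x) - w • ∑ j, u' j (c' j)))
        = ENNReal.ofReal (rtKernel (compPrec α β w n) (x'' - w • u 0 x) * rtKernel β (x - c 0)) := by
      intro x
      rw [← ENNReal.ofReal_mul (rtKernel_nonneg hβ.le _), mul_comm, hx'', sub_right_comm]
    have hval := integral_rtKernel_sub_smul_mul_rtKernel_sub hγ hβ w (u 0) x'' (c 0)
    have hint : Integrable (fun x : V => rtKernel (compPrec α β w n) (x'' - w • u 0 x) * rtKernel β (x - c 0)) := by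
      refine Integrable.of_integral_ne_zero ?_
      rw [hval]
      exact (rtKernel_pos (by positivity) _).ne'
    have h5 : ∫⁻ x : V, ENNReal.ofReal (rtKernel (compPrec α β w n) (x'' - w • u 0 x) * rtKernel β (x - c 0))
        = ENNReal.ofReal (rtKernel (compPrec α β w n * β / (β + w ^ 2 * compPrec α β w n)) (x'' - w • u 0 (c 0))) := by
      rw [← ofReal_integral_eq_lintegral_ofReal hint
        (Filter.Eventually.of_forall fun x => mul_nonneg (rtKernel_nonneg hγ.le _) (rtKernel_nonneg hβ.le _)), hval]
    -- assemble
    rw [volume_pi, h1, h2]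
    simp_rw [h3, h4]
    rw [h5, ← compPrec_succ hα hβ w n]
    congr 2
    rw [hx'', Fin.sum_univ_succ, smul_add]
    simp only [hu', hc']
    abel

/-- (2.12) over an arbitrary finite index type of sites, in Tonelli form (transport of `lintegral_fin_display212`
along `ι ≃ Fin |ι|`, `volume_measurePreserving_piCongrLeft`). [cite: Balaban1982Higgs1, (2.12) p.609] -/
theorem lintegral_display212 {ι : Type*} [Fintype ι] {α β : ℝ} (hα : 0 < α) (hβ : 0 < β) (w : ℝ)
    (u : ι → (V ≃ₗᵢ[ℝ] V)) (c : ι → V) (ψ : V) :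
    ∫⁻ θ : ι → V, ENNReal.ofReal (rtKernel α (ψ - w • ∑ y, u y (θ y)) * ∏ y, rtKernel β (θ y - c y))
      = ENNReal.ofReal (rtKernel (compPrec α β w (Fintype.card ι)) (ψ - w • ∑ y, u y (c y))) := by
  set f : Fin (Fintype.card ι) ≃ ι := (Fintype.equivFin ι).symm with hf
  set Φ := MeasurableEquiv.piCongrLeft (fun _ : ι => V) f with hΦ
  have hmp : MeasurePreserving Φ volume volume := volume_measurePreserving_piCongrLeft (fun _ : ι => V) f
  set G : (ι → V) → ℝ≥0∞ := fun θ =>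
    ENNReal.ofReal (rtKernel α (ψ - w • ∑ y, u y (θ y)) * ∏ y, rtKernel β (θ y - c y)) with hG
  have hΦapp : ∀ (g : Fin (Fintype.card ι) → V) (i : Fin (Fintype.card ι)), Φ g (f i) = g i := by
    intro g i
    rw [hΦ, MeasurableEquiv.coe_piCongrLeft, Equiv.piCongrLeft_apply_apply]
  have h1 : ∫⁻ θ, G θ = ∫⁻ g, G (Φ g) := (hmp.lintegral_comp_emb Φ.measurableEmbedding G).symm
  have h2 : ∀ g : Fin (Fintype.card ι) → V, G (Φ g)
      = ENNReal.ofReal (rtKernel α (ψ - w • ∑ i, u (f i) (g i)) * ∏ i, rtKernel β (g i - c (f i))) := by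
    intro g
    rw [hG]
    dsimp only
    rw [← f.sum_comp, ← f.prod_comp]
    simp only [hΦapp]
  change ∫⁻ θ, G θ = _
  rw [h1]
  simp_rw [h2]
  rw [lintegral_fin_display212 hα hβ w (Fintype.card ι) (fun i => u (f i)) (fun i => c (f i)) ψ]
  have hs : ∑ i, u (f i) (c (f i)) = ∑ y, u y (c y) := f.sum_comp (fun y => u y (c y))
  rw [hs]

variable (ι : Type*) [Fintype ι] (V)

/-- **(2.12)** p. 609, KERNEL (*"An easy Gaussian integration gives the formula"*): for every pair of
positive precisions α (↤ a(L^{k+1}ε)^{d−2}) and β (↤ a_k(L^kε)^{d−2}), every weight w (↤ L^{−d}), all isometric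
transports u_y (↤ U(A(Γ_{z,y}))) and block data c_y (↤ (Q_k(A)φ)(y)), integrating the block field θ↾_{B(z)} out of
t_α(ψ(z) − (Q(A)θ)(z))·Π_y t_β(θ(y) − (Q_k(A)φ)(y)) gives t_γ(ψ(z) − (Q_{k+1}(A)φ)(z)) with γ = `compPrec α β w |ι|`
(= a_{k+1}(L^{k+1}ε)^{d−2} for the printed data, `prec_comp`).  Proof = the printed one: one Gaussian integration per
site (`integral_rtKernel_sub_smul_mul_rtKernel_sub`) chained by Fubini–Tonelli over the sites of B(z)
(`lintegral_fin_display212`, `lintegral_display212`). [cite: Balaban1982Higgs1, (2.12) p.609] -/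
theorem display212 {α β : ℝ} (hα : 0 < α) (hβ : 0 < β) (w : ℝ) (u : ι → (V ≃ₗᵢ[ℝ] V)) (c : ι → V)
    (ψ : V) : Display212 ι V α β w u c ψ := by
  rw [display212_iff, integral_eq_lintegral_of_nonneg_ae
    (Filter.Eventually.of_forall fun θ => integrand212_nonneg hα.le hβ.le w u c ψ θ)
    (continuous_integrand212 α β w u c ψ).aestronglyMeasurable, lintegral_display212 hα hβ w u c ψ,
    ENNReal.toReal_ofReal (rtKernel_nonneg (compPrec_pos hα hβ w _).le _)]

end Composition2

end Literature.MathematicalPhysics.QuantumFieldTheory.Balaban1983to89.B1RT
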